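import Literature.Analysis.FunctionSpaces.TorusCubeDescentRungFluxApprox
import Literature.Analysis.FluidPDE.PassiveVectorTensorCubeDescent
import HarnessLib

/-!
# The descent ladder for weak tensor passive vectors from an ABSTRACT fixed-time flux bound, and its best-approximation form

Analysis/FluidPDE proof-support file (everything proved; no definitions, no named facts).  `PassiveVectorTensorCubeDescent`
proves the descent (`ae_rungEnergy_le_of_datum_off_ladder`) from slice hypotheses on the carrier measured against SHARP Fourier
truncations.  Here the induction is run once and for all from the a.e.-in-time FIXED-TIME FLUX INEQUALITY
  `|Flux_ℓ(s)| ≤ 2π(H_ℓ+2Δ)√E_ℓ(s) · [(2d²Λ/Δ)√E_{ℓ−1}(s) + d Σ_{i<ℓ−1} W(ℓ−1−i)√E_i(s) + d W(ℓ) ‖w(s)‖₂]`, `1 ≤ ℓ ≤ J+1`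
(`ae_rungEnergy_le_of_flux_bound`) — whatever estimate produces it — and then instantiated with the BEST-APPROXIMATION form of the
carrier's spectral tail (`TorusCubeDescentRungFluxApprox.abs_rungFlux_le_of_approx`: slices within `W n` of SOME real trigonometric
polynomial with frequencies in the cube `‖k‖_∞ ≤ nS − 2Δ`), `ae_rungEnergy_le_of_datum_off_ladder'` — the currency a Jackson /
Bohr–Favard estimate of an analytic carrier delivers without Lebesgue-constant losses (cell note F-k3l-8).
Conclusion in both: under the ladder condition `4π (K₀ + 2Δ) τ x (2d²Λ/Δ + d Σ_{n ≤ J} W(n+1) x^{n+1}) ≤ 1`, for `ℓ ≤ J+1` and a.e.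
`t ∈ (0,τ)`, `E_ℓ(w(t)) ≤ M₀² x^{−2ℓ}`.  Consumer: cell `ad-ideate`, K1L_D `stmt-AnomalousDissipation-27980`, W3-E (ii)
`stub_effectiveFrameEnergyL_bandKill` (F-k3l-7/8).
## Mathlib / tree search
Tree: `PassiveVectorTensorCubeDescent` (`ae_le_sq_of_ae_le_mul_setIntegral_sqrt`, the sharp-truncation descent — same proof skeleton),
`PassiveVectorTensorWeightedGalerkinIdentity`, `TorusCubeDescentRungFlux` (§13b tools), `TorusCubeDescentRungFluxApprox`.
## References
* R. J. DiPerna, P.-L. Lions, Invent. Math. 98 (1989), §II.1 Lemma II.1. [`DiPernaLions1989`]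
* R. Temam, *Navier–Stokes Equations* (1984), Ch. III §1 Lemma 1.2. [`Temam1984`] -/

noncomputable section

open MeasureTheory Set Filter Complex UnitAddTorus Function Finset
open scoped ENNReal InnerProductSpace ComplexConjugate

namespace Literature.Analysis.FluidPDE

namespace Torus

variable {d : Type*} [Fintype d] [DecidableEq d]

namespace IsWeakTensorPassiveVectorOn

/-- **THE DESCENT LADDER from an abstract fixed-time flux bound** (the form produced by `abs_rungFlux_le` /
`abs_rungFlux_le_of_approx`; only the a.e.-in-time inequality is used, so any future refinement of the fixed-time estimate
feeds this theorem unchanged).  Weak tensor-viscosity passive vectors:  `A = 0`, `NearIso 𝔸 lo hi` with `0 ≤ lo`; datum `w₀ ∈ L²` weakly divergence free whose Fourier coefficients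
VANISH on the ladder box `‖k‖_∞ ≤ K₀ + S + 2Δ`; energy bound `‖w(t)‖₂ ≤ M₀` a.e.; carrier slices a.e. continuous, weakly
divergence free, `Λ`-Lipschitz (`‖b x − b y‖ ≤ Λ‖FunctionSpaces.Torus.reprc(x−y)‖`) and within `W n` (sup norm) of their Fourier truncations at
radius `n S − 2Δ`, `1 ≤ n ≤ J + 1` (`J S ≤ K₀`, `2Δ ≤ S`).  If the LADDER CONDITION
`4π (K₀ + 2Δ) τ x (2d²Λ/Δ + d Σ_{n ≤ J} W(n+1) x^{n+1}) ≤ 1` holds (`x ≥ 1`, `τ ≤ T`), then every rung energy decays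
geometrically down the ladder: for `ℓ ≤ J + 1` and a.e. `t ∈ (0,τ)`,
`E_ℓ(w(t)) = Σ_k rungSym_ℓ(k)² |ŵ(t)(k)|² ≤ M₀² x^{−2ℓ}`; in particular the modes in the cube `‖k‖_∞ ≤ K₀ − J S` carry
energy at most `M₀² x^{−2(J+1)}`.  [cite: DiPernaLions1989, §II.1 Lemma II.1] [cite: Temam1984, Ch. III §1 Lemma 1.2] -/
theorem ae_rungEnergy_le_of_flux_bound {T : ℝ} {𝔸 : Visc4 d} {b w : ℝ → UnitAddTorus d → EuclideanSpace ℝ d}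
    {w₀ : UnitAddTorus d → EuclideanSpace ℝ d} (h : IsWeakTensorPassiveVectorOn 0 T 𝔸 b w₀ w)
    {lo hi : ℝ} (h𝔸 : NearIso 𝔸 lo hi) (hlo : 0 ≤ lo)
    (hw₀ : MemLp w₀ 2 volume) (hdiv₀ : FunctionSpaces.Torus.IsWeaklyDivFree w₀)
    {M₀ : ℝ} (hM₀ : 0 ≤ M₀) (hE : ∀ᵐ t ∂(volume.restrict (Ioo 0 T)), ∫ x, ‖w t x‖ ^ 2 ≤ M₀ ^ 2)
    {K₀ S Δ J : ℕ} (hΔ : 0 < Δ) (hJ : (J + 1) * S ≤ K₀ + S)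
    (hoff : ∀ k ∈ FunctionSpaces.Torus.ladderSupp d K₀ S Δ, mFourierCoeff (FunctionSpaces.EuclideanSpace.complexify ∘ w₀) k = 0)
    {Λ : ℝ} (hΛ : 0 ≤ Λ) {W : ℕ → ℝ} (hW0 : ∀ n, 0 ≤ W n)
    (hflux : ∀ ℓ, 1 ≤ ℓ → ℓ ≤ J + 1 → ∀ᵐ s ∂(volume.restrict (Ioo 0 T)),
      |∫ y, ⟪w s y, FunctionSpaces.Torus.convect (b s) (FunctionSpaces.Torus.realTrigPoly (FunctionSpaces.Torus.ladderSupp d K₀ S Δ)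
          (fun k => (((FunctionSpaces.Torus.rungSym K₀ S Δ ℓ k) ^ 2 : ℝ) : ℂ) •
            mFourierCoeff (FunctionSpaces.EuclideanSpace.complexify ∘ w s) k)) y⟫_ℝ| ≤
        2 * Real.pi * (FunctionSpaces.Torus.rungHeight K₀ S ℓ + 2 * Δ) * Real.sqrt (FunctionSpaces.Torus.rungEnergy K₀ S Δ ℓ (w s)) *
          (2 * (Fintype.card d) ^ 2 * Λ / Δ * Real.sqrt (FunctionSpaces.Torus.rungEnergy K₀ S Δ (ℓ - 1) (w s)) +
            Fintype.card d * ∑ i ∈ Finset.range (ℓ - 1), W (ℓ - 1 - i) * Real.sqrt (FunctionSpaces.Torus.rungEnergy K₀ S Δ i (w s)) +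
            Fintype.card d * W ℓ * Real.sqrt (∫ y, ‖w s y‖ ^ 2)))
    {τ x : ℝ} (hτ : 0 ≤ τ) (hτT : τ ≤ T) (hx : 1 ≤ x)
    (hladder : 4 * Real.pi * (K₀ + 2 * Δ) * τ * x *
      (2 * (Fintype.card d) ^ 2 * Λ / Δ + Fintype.card d * ∑ n ∈ Finset.range (J + 1), W (n + 1) * x ^ (n + 1)) ≤ 1) :
    ∀ ℓ, ℓ ≤ J + 1 → ∀ᵐ t ∂(volume.restrict (Ioo 0 τ)), FunctionSpaces.Torus.rungEnergy K₀ S Δ ℓ (w t) ≤ M₀ ^ 2 * (x⁻¹ ^ ℓ) ^ 2 := by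
  classical
  -- ### notation
  set F : Finset (d → ℤ) := FunctionSpaces.Torus.ladderSupp d K₀ S Δ with hF
  set X : ℝ → (d → ℤ) → EuclideanSpace ℂ d := fun s => mFourierCoeff (FunctionSpaces.EuclideanSpace.complexify ∘ w s) with hX
  set E : ℕ → ℝ → ℝ := fun ℓ s => FunctionSpaces.Torus.rungEnergy K₀ S Δ ℓ (w s) with hEdef
  set FL : ℕ → ℝ → ℝ := fun ℓ s => ∫ y, ⟪w s y, FunctionSpaces.Torus.convect (b s)
    (FunctionSpaces.Torus.realTrigPoly F (fun k => (((FunctionSpaces.Torus.rungSym K₀ S Δ ℓ k) ^ 2 : ℝ) : ℂ) • X s k)) y⟫_ℝ with hFL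
  set Γ : ℝ := 2 * (Fintype.card d) ^ 2 * Λ / Δ + Fintype.card d * ∑ n ∈ Finset.range (J + 1), W (n + 1) * x ^ (n + 1) with hΓ
  have hx0 : 0 < x := by linarith
  have hxi0 : 0 ≤ x⁻¹ := inv_nonneg.2 hx0.le
  have hΓ0 : 0 ≤ Γ := by
    have : 0 ≤ ∑ n ∈ Finset.range (J + 1), W (n + 1) * x ^ (n + 1) :=
      Finset.sum_nonneg fun n _ => mul_nonneg (hW0 _) (pow_nonneg hx0.le _)
    positivity
  have hsubT : Ioo (0:ℝ) τ ⊆ Ioo 0 T := Ioo_subset_Ioo le_rfl hτT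
  have hres : ∀ {P : ℝ → Prop}, (∀ᵐ s ∂(volume.restrict (Ioo 0 T)), P s) → ∀ᵐ s ∂(volume.restrict (Ioo 0 τ)), P s :=
    fun hP => ae_restrict_of_ae_restrict_of_subset hsubT hP
  -- ### measurability / integrability of the rung energies and fluxes
  have hEeq : ∀ ℓ s, E ℓ s = ∑ k ∈ F, FunctionSpaces.Torus.rungSym K₀ S Δ ℓ k ^ 2 * ‖X s k‖ ^ 2 := fun ℓ s => FunctionSpaces.Torus.rungEnergy_eq_sum_mul ℓ (w s)
  have hEint : ∀ ℓ, IntegrableOn (E ℓ) (Ioo 0 T) volume := by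
    intro ℓ
    have : IntegrableOn (fun s => ∑ k ∈ F, FunctionSpaces.Torus.rungSym K₀ S Δ ℓ k ^ 2 * ‖X s k‖ ^ 2) (Ioo 0 T) volume :=
      integrable_finsetSum _ fun k _ => (h.integrableOn_norm_sq_mFourierCoeff k).const_mul _
    exact this.congr_fun (fun s _ => (hEeq ℓ s).symm) measurableSet_Ioo
  have hEm : ∀ ℓ, AEStronglyMeasurable (E ℓ) (volume.restrict (Ioo 0 τ)) :=
    fun ℓ => ((hEint ℓ).mono_set hsubT).aestronglyMeasurable
  have hE0 : ∀ ℓ s, 0 ≤ E ℓ s := fun ℓ s => FunctionSpaces.Torus.rungEnergy_nonneg ℓ (w s)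
  -- the weighted test field in the two forms
  have hconv : ∀ ℓ s, (fun y => ∑ k ∈ F, (FunctionSpaces.Torus.rungSym K₀ S Δ ℓ k ^ 2) • FunctionSpaces.Torus.realTrigPoly {k} (fun k' => X s k') y) =
      FunctionSpaces.Torus.realTrigPoly F (fun k => (((FunctionSpaces.Torus.rungSym K₀ S Δ ℓ k) ^ 2 : ℝ) : ℂ) • X s k) :=
    fun ℓ s => FunctionSpaces.Torus.sum_smul_realTrigPoly_singleton F (fun k => FunctionSpaces.Torus.rungSym K₀ S Δ ℓ k ^ 2) (X s)
  have hFLint : ∀ ℓ, IntegrableOn (FL ℓ) (Ioo 0 T) volume := by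
    intro ℓ
    have hi := h.integrableOn_weightedFlux F (fun k => FunctionSpaces.Torus.rungSym K₀ S Δ ℓ k ^ 2)
    refine hi.congr_fun (fun s _ => ?_) measurableSet_Ioo
    simp only [zero_mul, add_zero, hFL, hX]
    rw [← hconv ℓ s]
  -- ### STEP 1: the weighted energy identity ⇒ `E_ℓ(t) ≤ 2 ∫_{(0,t]} |FL_ℓ|`
  have hstep1 : ∀ ℓ, ∀ᵐ t ∂(volume.restrict (Ioo 0 T)), E ℓ t ≤ 2 * ∫ s in Ioc 0 t, |FL ℓ s| := by
    intro ℓ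
    have hnn := h.ae_re_inner_symbT_nonneg h𝔸 hlo
    have hnn' := (ae_restrict_iff' (measurableSet_Ioo : MeasurableSet (Ioo (0:ℝ) T))).1 hnn
    filter_upwards [h.ae_weighted_sum_sq_norm_mFourierCoeff_eq hw₀ hdiv₀,
      ae_restrict_mem (measurableSet_Ioo : MeasurableSet (Ioo (0:ℝ) T))] with t ht htT
    have hid := ht F (fun k => FunctionSpaces.Torus.rungSym K₀ S Δ ℓ k ^ 2)
    have hsub : Ioc 0 t ⊆ Ioo 0 T := fun s hs => ⟨hs.1, lt_of_le_of_lt hs.2 htT.2⟩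
    -- the datum term vanishes
    have h0 : ∑ k ∈ F, FunctionSpaces.Torus.rungSym K₀ S Δ ℓ k ^ 2 * ‖mFourierCoeff (FunctionSpaces.EuclideanSpace.complexify ∘ w₀) k‖ ^ 2 = 0 :=
      Finset.sum_eq_zero fun k hk => by rw [hoff k hk, norm_zero]; ring
    -- the dissipation term is nonnegative
    have hD : 0 ≤ ∫ s in Ioc 0 t, 4 * Real.pi ^ 2 * ∑ k ∈ F, FunctionSpaces.Torus.rungSym K₀ S Δ ℓ k ^ 2 *
        (⟪mFourierCoeff (FunctionSpaces.EuclideanSpace.complexify ∘ w s) k,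
          symbT 𝔸 k (mFourierCoeff (FunctionSpaces.EuclideanSpace.complexify ∘ w s) k)⟫_ℂ).re := by
      refine setIntegral_nonneg_of_ae_restrict ((ae_restrict_iff' measurableSet_Ioc).2 (hnn'.mono fun s hs hsI => ?_))
      have := hs (hsub hsI)
      exact mul_nonneg (by positivity) (Finset.sum_nonneg fun k _ => mul_nonneg (sq_nonneg _) (this k))
    -- the flux term in the `FunctionSpaces.Torus.realTrigPoly` form
    have hfl : ∫ s in Ioc 0 t, ((∫ y, ⟪w s y, FunctionSpaces.Torus.convect (b s) (fun y => ∑ k ∈ F, (FunctionSpaces.Torus.rungSym K₀ S Δ ℓ k ^ 2) •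
          FunctionSpaces.Torus.realTrigPoly {k} (fun k' => mFourierCoeff (FunctionSpaces.EuclideanSpace.complexify ∘ w s) k') y) y⟫_ℝ) +
        0 * ∫ y, ⟪b s y, FunctionSpaces.Torus.convect (w s) (fun y => ∑ k ∈ F, (FunctionSpaces.Torus.rungSym K₀ S Δ ℓ k ^ 2) •
          FunctionSpaces.Torus.realTrigPoly {k} (fun k' => mFourierCoeff (FunctionSpaces.EuclideanSpace.complexify ∘ w s) k') y) y⟫_ℝ) =
        ∫ s in Ioc 0 t, FL ℓ s := by
      refine setIntegral_congr_fun measurableSet_Ioc fun s _ => ?_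
      simp only [zero_mul, add_zero, hFL, hX]
      rw [← hconv ℓ s]
    have habs : ∫ s in Ioc 0 t, FL ℓ s ≤ ∫ s in Ioc 0 t, |FL ℓ s| :=
      integral_mono_ae ((hFLint ℓ).mono_set hsub) ((hFLint ℓ).mono_set hsub).abs (ae_of_all _ fun s => le_abs_self _)
    have hEt : E ℓ t = ∑ k ∈ F, FunctionSpaces.Torus.rungSym K₀ S Δ ℓ k ^ 2 * ‖mFourierCoeff (FunctionSpaces.EuclideanSpace.complexify ∘ w t) k‖ ^ 2 := hEeq ℓ t
    rw [h0, hfl] at hid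
    linarith
  -- ### STEP 2: induction down the ladder
  suffices hind : ∀ ℓ, ℓ ≤ J + 1 → ∀ i, i ≤ ℓ → ∀ᵐ t ∂(volume.restrict (Ioo 0 τ)), E i t ≤ M₀ ^ 2 * (x⁻¹ ^ i) ^ 2 from
    fun ℓ hℓ => hind ℓ hℓ ℓ le_rfl
  intro ℓ
  induction ℓ with
  | zero =>
    intro _ i hi
    obtain rfl : i = 0 := Nat.le_zero.1 hi
    filter_upwards [hres hE, hres h.ae_memLp_two] with t ht h2
    simp only [pow_zero, one_pow, mul_one]
    exact (FunctionSpaces.Torus.rungEnergy_le_integral_norm_sq 0 h2).trans ht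
  | succ ℓ ih =>
    intro hℓJ i hi
    have ih' := ih (Nat.le_of_succ_le hℓJ)
    rcases Nat.lt_or_ge i (ℓ + 1) with hlt | hge
    · exact ih' i (Nat.lt_succ_iff.1 hlt)
    obtain rfl : i = ℓ + 1 := le_antisymm hi hge
    -- all lower rungs at once, a.e. in `s ∈ (0,τ)`
    have hlow : ∀ᵐ s ∂(volume.restrict (Ioo 0 τ)), ∀ i, i ≤ ℓ → E i s ≤ M₀ ^ 2 * (x⁻¹ ^ i) ^ 2 := by
      refine ae_all_iff.2 fun i => ?_
      by_cases hi : i ≤ ℓ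
      · filter_upwards [ih' i hi] with s hs; exact fun _ => hs
      · exact ae_of_all _ fun s hi' => absurd hi' hi
    -- geometry of rung `ℓ + 1`
    have hℓS : (ℓ + 1) * S ≤ K₀ + S := le_trans (Nat.mul_le_mul_right _ hℓJ) hJ
    set H : ℕ := FunctionSpaces.Torus.rungHeight K₀ S (ℓ + 1) with hH
    have hHK : (H : ℝ) ≤ K₀ := by exact_mod_cast FunctionSpaces.Torus.rungHeight_succ_le (K₀ := K₀) (S := S) ℓ
    set c : ℝ := 4 * Real.pi * (H + 2 * Δ) * (M₀ * x⁻¹ ^ ℓ * Γ) with hc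
    have hc0 : 0 ≤ c := by positivity
    -- ### the a.e.-in-`s` flux bound `|FL_{ℓ+1}(s)| ≤ (c/2) √E_{ℓ+1}(s)` on `(0,τ)`
    have hflux : ∀ᵐ s ∂(volume.restrict (Ioo 0 τ)), |FL (ℓ + 1) s| ≤ c / 2 * Real.sqrt (E (ℓ + 1) s) := by
      filter_upwards [hlow, hres (hflux (ℓ + 1) (Nat.le_add_left 1 ℓ) hℓJ), hres h.ae_memLp_two, hres hE]
        with s hlow_s hfix h2_s hE_s
      simp only [Nat.add_sub_cancel] at hfix
      have hbr := FunctionSpaces.Torus.ladder_bracket_le (Nat.succ_le_succ_iff.1 hℓJ) hx hM₀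
        (show (0:ℝ) ≤ 2 * (Fintype.card d) ^ 2 * Λ / Δ by positivity) (Nat.cast_nonneg (Fintype.card d)) hW0
        (e := fun i => Real.sqrt (E i s)) (fun i hi => ?_) (e' := Real.sqrt (∫ y, ‖w s y‖ ^ 2)) ?_
      rotate_left
      · calc Real.sqrt (E i s) ≤ Real.sqrt (M₀ ^ 2 * (x⁻¹ ^ i) ^ 2) := Real.sqrt_le_sqrt (hlow_s i hi)
          _ = M₀ * x⁻¹ ^ i := by rw [← mul_pow, Real.sqrt_sq (mul_nonneg hM₀ (pow_nonneg hxi0 _))]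
      · calc Real.sqrt (∫ y, ‖w s y‖ ^ 2) ≤ Real.sqrt (M₀ ^ 2) := Real.sqrt_le_sqrt hE_s
          _ = M₀ := Real.sqrt_sq hM₀
      have hsq0 : 0 ≤ Real.sqrt (E (ℓ + 1) s) := Real.sqrt_nonneg _
      have hHΔ : (0:ℝ) ≤ 2 * Real.pi * (H + 2 * Δ) := by positivity
      calc |FL (ℓ + 1) s| ≤ 2 * Real.pi * (H + 2 * Δ) * Real.sqrt (E (ℓ + 1) s) *
            (2 * (Fintype.card d) ^ 2 * Λ / Δ * Real.sqrt (E ℓ s) +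
              Fintype.card d * ∑ i ∈ Finset.range ℓ, W (ℓ - i) * Real.sqrt (E i s) +
              Fintype.card d * W (ℓ + 1) * Real.sqrt (∫ y, ‖w s y‖ ^ 2)) := hfix
        _ ≤ 2 * Real.pi * (H + 2 * Δ) * Real.sqrt (E (ℓ + 1) s) * (M₀ * x⁻¹ ^ ℓ * Γ) := by
            refine mul_le_mul_of_nonneg_left ?_ (mul_nonneg hHΔ hsq0)
            rw [← hΓ] at hbr
            exact hbr
        _ = c / 2 * Real.sqrt (E (ℓ + 1) s) := by rw [hc]; ring
    -- ### integrate: `E_{ℓ+1}(t) ≤ c ∫_{(0,t]} √E_{ℓ+1}` a.e. on `(0,τ)`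
    have hflux' := (ae_restrict_iff' (measurableSet_Ioo : MeasurableSet (Ioo (0:ℝ) τ))).1 hflux
    have hEB : ∀ᵐ t ∂(volume.restrict (Ioo 0 τ)), E (ℓ + 1) t ≤ M₀ ^ 2 := by
      filter_upwards [hres hE, hres h.ae_memLp_two] with t ht h2
      exact (FunctionSpaces.Torus.rungEnergy_le_integral_norm_sq (ℓ + 1) h2).trans ht
    have hEB' := (ae_restrict_iff' (measurableSet_Ioo : MeasurableSet (Ioo (0:ℝ) τ))).1 hEB
    have hSm' : AEStronglyMeasurable (fun s => Real.sqrt (E (ℓ + 1) s)) (volume.restrict (Ioo 0 τ)) :=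
      Real.continuous_sqrt.comp_aestronglyMeasurable (hEm (ℓ + 1))
    have hstep : ∀ᵐ t ∂(volume.restrict (Ioo 0 τ)), E (ℓ + 1) t ≤ c * ∫ s in Ioc 0 t, Real.sqrt (E (ℓ + 1) s) := by
      filter_upwards [hres (hstep1 (ℓ + 1)), ae_restrict_mem (measurableSet_Ioo : MeasurableSet (Ioo (0:ℝ) τ))]
        with t ht htI
      have hsub : Ioc 0 t ⊆ Ioo 0 τ := fun s hs => ⟨hs.1, lt_of_le_of_lt hs.2 htI.2⟩
      have hsub' : Ioc 0 t ⊆ Ioo 0 T := hsub.trans hsubT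
      have hfin : volume (Ioc (0:ℝ) t) < ⊤ := by rw [Real.volume_Ioc]; exact ENNReal.ofReal_lt_top
      have hi1 : IntegrableOn (fun s => |FL (ℓ + 1) s|) (Ioc 0 t) volume := ((hFLint (ℓ + 1)).mono_set hsub').abs
      have hi2 : IntegrableOn (fun s => c / 2 * Real.sqrt (E (ℓ + 1) s)) (Ioc 0 t) volume := by
        refine IntegrableOn.of_bound hfin ((hSm'.mono_measure (Measure.restrict_mono hsub le_rfl)).const_mul _)
          (c / 2 * M₀) ((ae_restrict_iff' measurableSet_Ioc).2 (hEB'.mono fun s hs hsI => ?_))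
        rw [Real.norm_eq_abs, abs_of_nonneg (by positivity)]
        refine mul_le_mul_of_nonneg_left ?_ (by positivity)
        calc Real.sqrt (E (ℓ + 1) s) ≤ Real.sqrt (M₀ ^ 2) := Real.sqrt_le_sqrt (hs (hsub hsI))
          _ = M₀ := Real.sqrt_sq hM₀
      have hmono : ∫ s in Ioc 0 t, |FL (ℓ + 1) s| ≤ ∫ s in Ioc 0 t, c / 2 * Real.sqrt (E (ℓ + 1) s) :=
        integral_mono_ae hi1 hi2 ((ae_restrict_iff' measurableSet_Ioc).2 (hflux'.mono fun s hs hsI => hs (hsub hsI)))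
      rw [integral_const_mul] at hmono
      calc E (ℓ + 1) t ≤ 2 * ∫ s in Ioc 0 t, |FL (ℓ + 1) s| := ht
        _ ≤ 2 * (c / 2 * ∫ s in Ioc 0 t, Real.sqrt (E (ℓ + 1) s)) := by linarith
        _ = c * ∫ s in Ioc 0 t, Real.sqrt (E (ℓ + 1) s) := by ring
    -- ### the scalar step and the ladder condition
    have hfinal := ae_le_sq_of_ae_le_mul_setIntegral_sqrt hc0 hτ (hEm (ℓ + 1)) hEB hstep
    have hcτ : c * τ ≤ M₀ * x⁻¹ ^ (ℓ + 1) := by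
      -- `c τ = 4π(H+2Δ) τ Γ · M₀ x^{-ℓ}` and `4π(H+2Δ) τ Γ x ≤ 4π(K₀+2Δ) τ x Γ ≤ 1`
      have h1 : 4 * Real.pi * (H + 2 * Δ) * τ * x * Γ ≤ 1 := by
        calc 4 * Real.pi * (H + 2 * Δ) * τ * x * Γ ≤ 4 * Real.pi * (K₀ + 2 * Δ) * τ * x * Γ := by
              have : (0:ℝ) ≤ 4 * Real.pi := by positivity
              have hτxΓ : 0 ≤ τ * x * Γ := by positivity
              nlinarith [mul_nonneg (mul_nonneg this hτxΓ) (sub_nonneg.2 hHK)]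
          _ ≤ 1 := hladder
      have hMx : 0 ≤ M₀ * x⁻¹ ^ (ℓ + 1) := by positivity
      calc c * τ = (4 * Real.pi * (H + 2 * Δ) * τ * x * Γ) * (M₀ * x⁻¹ ^ (ℓ + 1)) := by
            rw [hc, pow_succ]; field_simp
        _ ≤ 1 * (M₀ * x⁻¹ ^ (ℓ + 1)) := mul_le_mul_of_nonneg_right h1 hMx
        _ = _ := one_mul _
    filter_upwards [hfinal] with t ht
    calc E (ℓ + 1) t ≤ (c * τ) ^ 2 := ht
      _ ≤ (M₀ * x⁻¹ ^ (ℓ + 1)) ^ 2 := pow_le_pow_left₀ (by positivity) hcτ 2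
      _ = M₀ ^ 2 * (x⁻¹ ^ (ℓ + 1)) ^ 2 := by ring


/-- **THE DESCENT LADDER, best-approximation form of the carrier's spectral tail** (F-k3l-8): as
`ae_rungEnergy_le_of_datum_off_ladder`, but the slices of the carrier need only be within `W n` (sup norm) of SOME real
trigonometric polynomial with frequencies in the cube `‖k‖_∞ ≤ n S − 2Δ` (`1 ≤ n ≤ J+1`), not of their sharp Fourier truncations.
[cite: DiPernaLions1989, §II.1 Lemma II.1] [cite: Temam1984, Ch. III §1 Lemma 1.2] -/
theorem ae_rungEnergy_le_of_datum_off_ladder' {T : ℝ} {𝔸 : Visc4 d} {b w : ℝ → UnitAddTorus d → EuclideanSpace ℝ d}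
    {w₀ : UnitAddTorus d → EuclideanSpace ℝ d} (h : IsWeakTensorPassiveVectorOn 0 T 𝔸 b w₀ w)
    {lo hi : ℝ} (h𝔸 : NearIso 𝔸 lo hi) (hlo : 0 ≤ lo)
    (hw₀ : MemLp w₀ 2 volume) (hdiv₀ : FunctionSpaces.Torus.IsWeaklyDivFree w₀)
    {M₀ : ℝ} (hM₀ : 0 ≤ M₀) (hE : ∀ᵐ t ∂(volume.restrict (Ioo 0 T)), ∫ x, ‖w t x‖ ^ 2 ≤ M₀ ^ 2)
    {K₀ S Δ J : ℕ} (hΔ : 0 < Δ) (hS : 2 * Δ ≤ S) (hJ : (J + 1) * S ≤ K₀ + S)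
    (hoff : ∀ k ∈ FunctionSpaces.Torus.ladderSupp d K₀ S Δ, mFourierCoeff (FunctionSpaces.EuclideanSpace.complexify ∘ w₀) k = 0)
    (hbc : ∀ᵐ s ∂(volume.restrict (Ioo 0 T)), Continuous (b s))
    {Λ : ℝ} (hΛ : 0 ≤ Λ) (hbL : ∀ᵐ s ∂(volume.restrict (Ioo 0 T)), ∀ x y, ‖b s x - b s y‖ ≤ Λ * ‖FunctionSpaces.Torus.reprc (x - y)‖)
    {W : ℕ → ℝ} (hW0 : ∀ n, 0 ≤ W n)
    (hW : ∀ᵐ s ∂(volume.restrict (Ioo 0 T)), ∀ n, 1 ≤ n → n ≤ J + 1 → ∃ t : (d → ℤ) → EuclideanSpace ℂ d,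
      FunctionSpaces.Torus.IsConjSymm t ∧
        ∀ x, ‖b s x - FunctionSpaces.Torus.realTrigPoly (FunctionSpaces.Torus.cubeSupp d (n * S - 2 * Δ)) t x‖ ≤ W n)
    {τ x : ℝ} (hτ : 0 ≤ τ) (hτT : τ ≤ T) (hx : 1 ≤ x)
    (hladder : 4 * Real.pi * (K₀ + 2 * Δ) * τ * x *
      (2 * (Fintype.card d) ^ 2 * Λ / Δ + Fintype.card d * ∑ n ∈ Finset.range (J + 1), W (n + 1) * x ^ (n + 1)) ≤ 1) :
    ∀ ℓ, ℓ ≤ J + 1 → ∀ᵐ t ∂(volume.restrict (Ioo 0 τ)),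
      FunctionSpaces.Torus.rungEnergy K₀ S Δ ℓ (w t) ≤ M₀ ^ 2 * (x⁻¹ ^ ℓ) ^ 2 := by
  refine h.ae_rungEnergy_le_of_flux_bound h𝔸 hlo hw₀ hdiv₀ hM₀ hE hΔ hJ hoff hΛ hW0 (fun ℓ hℓ1 hℓJ => ?_) hτ hτT hx hladder
  have hℓS : ℓ * S ≤ K₀ + S := le_trans (Nat.mul_le_mul_right _ hℓJ) hJ
  filter_upwards [hbc, hbL, hW, h.ae_isWeaklyDivFree_carrier, h.ae_memLp_two] with s hbc_s hbL_s hW_s hdiv_s h2_s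
  exact FunctionSpaces.Torus.abs_rungFlux_le_of_approx (K₀ := K₀) hΔ hS hℓ1 hℓS hbc_s hdiv_s hΛ hbL_s h2_s
    (W := W) (fun n hn hnℓ => hW_s n hn (hnℓ.trans hℓJ))

end IsWeakTensorPassiveVectorOn

end Torus

end Literature.Analysis.FluidPDE

end
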